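import Literature.MathematicalPhysics.QuantumFieldTheory.TwistReflectionCovariance
import HarnessLib

/-!
# 't Hooft's duality rotation (6.1)–(6.2) on the symmetric lattice torus:
# `W{k̃, k₃; m̃, m₃} = W{m̃, k₃; k̃, m₃}`

Topic `Literature/MathematicalPhysics/QuantumFieldTheory`; sequel of `TwistSectorOperations.lean` (`transposeTwist`,
`invertDir`), `TwistedPartitionFunctionMonotone.lean` (`twistZ_transposeTwist`) and `TwistReflectionCovariance.lean`
(`twistZ_invertDir`), in the vocabulary of `THooftElectricFlux.lean` (`temporalTensor k`: `n_{0,j+1} = k_j`, time =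
direction `0`).

## What is proved

G. 't Hooft, Nucl. Phys. B153 (1979) 141 [tHooft1979Flux], §6 (reprint p. 553–554): «Clearly, W will be invariant
under joint rotations of `a_μ` and `n_{μν}` in Euclidean space. In particular, let us perform the SO(4) rotation
(6.1) `x₁ ↦ -x₂, x₂ ↦ x₁, x₃ ↦ x₄, x₄ ↦ -x₃` (keeping in mind that `k_i = n_{4i}` and `n_{ij} = ε_{ijk} m_k`). Let
the first two components of a vector `x` be denoted by `x̃`, and let `â` be `ã` with its two components
interchanged. Then we find (6.2) `W{k̃, k₃, m̃, m₃; ã, a₃, β} = W{m̃, k₃, k̃, m₃; â, β, a₃}`.»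

On the SYMMETRIC lattice torus `(ℤ/Lℤ)⁴` (all `a_μ = β = L`, so the box arguments of both sides coincide) and with
the tree's time direction `0` in place of 't Hooft's `4`:

* `THooftFlux.magneticTensor m` — the dictionary `n_{ij} = ε_{ijk} m_k` of the spatial planes (`n₁₂ = m₃`,
  `n₁₃ = -m₂`, `n₂₃ = m₁`; components `m = (m 0, m 1, m 2) = (m₁, m₂, m₃)`), so that 't Hooft's `{k, m}` is the tensor
  `magneticTensor m + temporalTensor k`; its six components (`fluxTensor_apply_…`);
* the rotation (6.1) realised on twists as `R z = invertDir 0 (invertDir 2 (transposeTwist 0 3 (transposeTwist 1 2 z)))`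
  (transpose the axes `1 ↔ 2` and `0 ↔ 3`, then reverse the axes `0` and `2`), its component table for an
  arbitrary compact `G` (`dualityRotation_apply_…`: `(Rz)₀₁ = z₂₃`, `(Rz)₀₂ = z₁₃⁻¹`, `(Rz)₀₃ = z₀₃`, `(Rz)₁₂ = z₁₂`,
  `(Rz)₁₃ = z₀₂⁻¹`, `(Rz)₂₃ = z₀₁`), and ★ `MultiTwist.twistZ_dualityRotation`: `Z(Rz) = Z(z)` (any compact `G`,
  continuous `ρ`, real `β`, `L ≥ 2`);
* ★★ `MultiTwist.sun_twistZ_duality` — (6.2) AS PRINTED for `SU(N)`: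
  `W{(k₁,k₂,k₃), (m₁,m₂,m₃)} = W{(m₁,m₂,k₃), (k₁,k₂,m₃)}`, i.e. `k̃ ↔ m̃` exchanged, `k₃`, `m₃` kept
  (`dualityRotation_twistOfTensor`: `R` maps the tensor of `(k, m)` to the tensor of `((m̃, k₃), (k̃, m₃))` exactly,
  signs included, under the dictionary above).

Scope / HONEST FRAMING: finite symmetric torus only — the exchange `â, β ↔ a₃` of the box sides in (6.2) is
invisible here (all sides equal), and the duality equation (6.3) (Fourier transform of (6.2)) is not asserted in
this file.  `d = 4`.

## References
* G. 't Hooft, Nucl. Phys. B153 (1979) 141–160, §2 eq. (2.5), §6 eqs. (6.1)–(6.2) (reprint: C. Rebbi (ed.),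
  *Lattice Gauge Theories and Monte Carlo Simulations*, World Scientific, pp. 553–554). [tHooft1979Flux]
-/

open MeasureTheory Finset
open scoped BigOperators

namespace Literature.MathematicalPhysics.QuantumFieldTheory

noncomputable section

/-! ## 't Hooft's `(k, m)` dictionary in four dimensions -/

namespace THooftFlux

variable {N : ℕ}

/-- **'t Hooft's magnetic dictionary** `n_{ij} = ε_{ijk} m_k` (Nucl. Phys. B153 §2 (2.5) and §6 «keeping in mind that
`n_{ij} = ε_{ijk} m_k`»), time = direction `0`, space = `1, 2, 3`: the tensor with `n₁₂ = m₃`, `n₁₃ = -m₂`, `n₂₃ = m₁`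
and vanishing temporal components; `m = (m 0, m 1, m 2) = (m₁, m₂, m₃)`. [cite: tHooft1979Flux, §2 eq. (2.5)] -/
def magneticTensor (m : Fin 3 → ZMod N) : QuantumLattice.Plane 4 → ZMod N :=
  fun q => if q.1 = (1, 2) then m 2 else if q.1 = (1, 3) then -m 1 else if q.1 = (2, 3) then m 0 else 0

/-- The magnetic tensor has no temporal components. [cite: tHooft1979Flux, §2 eq. (2.5)] -/
theorem magneticTensor_of_eq_zero (m : Fin 3 → ZMod N) (q : QuantumLattice.Plane 4) (hq : q.1.1 = 0) :
    magneticTensor m q = 0 := by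
  obtain ⟨⟨i, j⟩, hij⟩ := q
  simp only at hq
  subst hq
  unfold magneticTensor
  simp

/-- `{k, m}₀₁ = k₁`. [cite: tHooft1979Flux, §2 eq. (2.5)] -/
theorem fluxTensor_apply_01 (k m : Fin 3 → ZMod N) (h : (0 : Fin 4) < 1) :
    (magneticTensor m + temporalTensor k) ⟨(0, 1), h⟩ = k 0 := by
  rw [Pi.add_apply, magneticTensor_of_eq_zero m _ rfl, zero_add]
  exact temporalTensor_temporal k 0

/-- `{k, m}₀₂ = k₂`. [cite: tHooft1979Flux, §2 eq. (2.5)] -/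
theorem fluxTensor_apply_02 (k m : Fin 3 → ZMod N) (h : (0 : Fin 4) < 2) :
    (magneticTensor m + temporalTensor k) ⟨(0, 2), h⟩ = k 1 := by
  rw [Pi.add_apply, magneticTensor_of_eq_zero m _ rfl, zero_add]
  exact temporalTensor_temporal k 1

/-- `{k, m}₀₃ = k₃`. [cite: tHooft1979Flux, §2 eq. (2.5)] -/
theorem fluxTensor_apply_03 (k m : Fin 3 → ZMod N) (h : (0 : Fin 4) < 3) :
    (magneticTensor m + temporalTensor k) ⟨(0, 3), h⟩ = k 2 := by
  rw [Pi.add_apply, magneticTensor_of_eq_zero m _ rfl, zero_add]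
  exact temporalTensor_temporal k 2

/-- `{k, m}₁₂ = m₃`. [cite: tHooft1979Flux, §2 eq. (2.5)] -/
theorem fluxTensor_apply_12 (k m : Fin 3 → ZMod N) (h : (1 : Fin 4) < 2) :
    (magneticTensor m + temporalTensor k) ⟨(1, 2), h⟩ = m 2 := by
  rw [Pi.add_apply, temporalTensor_of_ne_zero k _ (show (1 : Fin 4) ≠ 0 by decide), add_zero]
  unfold magneticTensor
  simp

/-- `{k, m}₁₃ = -m₂`. [cite: tHooft1979Flux, §2 eq. (2.5)] -/
theorem fluxTensor_apply_13 (k m : Fin 3 → ZMod N) (h : (1 : Fin 4) < 3) :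
    (magneticTensor m + temporalTensor k) ⟨(1, 3), h⟩ = -m 1 := by
  rw [Pi.add_apply, temporalTensor_of_ne_zero k _ (show (1 : Fin 4) ≠ 0 by decide), add_zero]
  unfold magneticTensor
  simp

/-- `{k, m}₂₃ = m₁`. [cite: tHooft1979Flux, §2 eq. (2.5)] -/
theorem fluxTensor_apply_23 (k m : Fin 3 → ZMod N) (h : (2 : Fin 4) < 3) :
    (magneticTensor m + temporalTensor k) ⟨(2, 3), h⟩ = m 0 := by
  rw [Pi.add_apply, temporalTensor_of_ne_zero k _ (show (2 : Fin 4) ≠ 0 by decide), add_zero]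
  unfold magneticTensor
  simp

end THooftFlux

/-! ## The rotation (6.1) on twists and its component table -/

namespace MultiTwist

open QuantumLattice

section Components

variable {G : Type*} [Group G]

/-- `(Rz)₀₁ = z₂₃`. [cite: tHooft1979Flux, §6 eq. (6.1)] -/
theorem dualityRotation_apply_01 (z : Twist 4 G) (h : (0 : Fin 4) < 1) :
    invertDir 0 (invertDir 2 (transposeTwist 0 3 (transposeTwist 1 2 z))) ⟨(0, 1), h⟩ = z ⟨(2, 3), by decide⟩ := by
  rw [invertDir_apply, if_pos (Or.inl rfl), invertDir_apply, if_neg (show ¬((0 : Fin 4) = 2 ∨ (1 : Fin 4) = 2) by decide)]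
  change (extend (transposeTwist 1 2 z) (Equiv.swap (0 : Fin 4) 3 0) (Equiv.swap (0 : Fin 4) 3 1))⁻¹ = _
  rw [extend_transposeTwist,
    show Equiv.swap (1 : Fin 4) 2 (Equiv.swap (0 : Fin 4) 3 0) = 3 by decide,
    show Equiv.swap (1 : Fin 4) 2 (Equiv.swap (0 : Fin 4) 3 1) = 2 by decide,
    extend_of_gt z (show (2 : Fin 4) < 3 by decide), inv_inv]

/-- `(Rz)₀₂ = z₁₃⁻¹`. [cite: tHooft1979Flux, §6 eq. (6.1)] -/
theorem dualityRotation_apply_02 (z : Twist 4 G) (h : (0 : Fin 4) < 2) :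
    invertDir 0 (invertDir 2 (transposeTwist 0 3 (transposeTwist 1 2 z))) ⟨(0, 2), h⟩ = (z ⟨(1, 3), by decide⟩)⁻¹ := by
  rw [invertDir_apply, if_pos (Or.inl rfl), invertDir_apply, if_pos (Or.inr rfl)]
  change ((extend (transposeTwist 1 2 z) (Equiv.swap (0 : Fin 4) 3 0) (Equiv.swap (0 : Fin 4) 3 2))⁻¹)⁻¹ = _
  rw [inv_inv, extend_transposeTwist,
    show Equiv.swap (1 : Fin 4) 2 (Equiv.swap (0 : Fin 4) 3 0) = 3 by decide,
    show Equiv.swap (1 : Fin 4) 2 (Equiv.swap (0 : Fin 4) 3 2) = 1 by decide,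
    extend_of_gt z (show (1 : Fin 4) < 3 by decide)]

/-- `(Rz)₀₃ = z₀₃`. [cite: tHooft1979Flux, §6 eq. (6.1)] -/
theorem dualityRotation_apply_03 (z : Twist 4 G) (h : (0 : Fin 4) < 3) :
    invertDir 0 (invertDir 2 (transposeTwist 0 3 (transposeTwist 1 2 z))) ⟨(0, 3), h⟩ = z ⟨(0, 3), by decide⟩ := by
  rw [invertDir_apply, if_pos (Or.inl rfl), invertDir_apply, if_neg (show ¬((0 : Fin 4) = 2 ∨ (3 : Fin 4) = 2) by decide)]
  change (extend (transposeTwist 1 2 z) (Equiv.swap (0 : Fin 4) 3 0) (Equiv.swap (0 : Fin 4) 3 3))⁻¹ = _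
  rw [extend_transposeTwist,
    show Equiv.swap (1 : Fin 4) 2 (Equiv.swap (0 : Fin 4) 3 0) = 3 by decide,
    show Equiv.swap (1 : Fin 4) 2 (Equiv.swap (0 : Fin 4) 3 3) = 0 by decide,
    extend_of_gt z (show (0 : Fin 4) < 3 by decide), inv_inv]

/-- `(Rz)₁₂ = z₁₂`. [cite: tHooft1979Flux, §6 eq. (6.1)] -/
theorem dualityRotation_apply_12 (z : Twist 4 G) (h : (1 : Fin 4) < 2) :
    invertDir 0 (invertDir 2 (transposeTwist 0 3 (transposeTwist 1 2 z))) ⟨(1, 2), h⟩ = z ⟨(1, 2), by decide⟩ := by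
  rw [invertDir_apply, if_neg (show ¬((1 : Fin 4) = 0 ∨ (2 : Fin 4) = 0) by decide), invertDir_apply, if_pos (Or.inr rfl)]
  change (extend (transposeTwist 1 2 z) (Equiv.swap (0 : Fin 4) 3 1) (Equiv.swap (0 : Fin 4) 3 2))⁻¹ = _
  rw [extend_transposeTwist,
    show Equiv.swap (1 : Fin 4) 2 (Equiv.swap (0 : Fin 4) 3 1) = 2 by decide,
    show Equiv.swap (1 : Fin 4) 2 (Equiv.swap (0 : Fin 4) 3 2) = 1 by decide,
    extend_of_gt z (show (1 : Fin 4) < 2 by decide), inv_inv]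

/-- `(Rz)₁₃ = z₀₂⁻¹`. [cite: tHooft1979Flux, §6 eq. (6.1)] -/
theorem dualityRotation_apply_13 (z : Twist 4 G) (h : (1 : Fin 4) < 3) :
    invertDir 0 (invertDir 2 (transposeTwist 0 3 (transposeTwist 1 2 z))) ⟨(1, 3), h⟩ = (z ⟨(0, 2), by decide⟩)⁻¹ := by
  rw [invertDir_apply, if_neg (show ¬((1 : Fin 4) = 0 ∨ (3 : Fin 4) = 0) by decide), invertDir_apply, if_neg (show ¬((1 : Fin 4) = 2 ∨ (3 : Fin 4) = 2) by decide)]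
  change extend (transposeTwist 1 2 z) (Equiv.swap (0 : Fin 4) 3 1) (Equiv.swap (0 : Fin 4) 3 3) = _
  rw [extend_transposeTwist,
    show Equiv.swap (1 : Fin 4) 2 (Equiv.swap (0 : Fin 4) 3 1) = 2 by decide,
    show Equiv.swap (1 : Fin 4) 2 (Equiv.swap (0 : Fin 4) 3 3) = 0 by decide,
    extend_of_gt z (show (0 : Fin 4) < 2 by decide)]

/-- `(Rz)₂₃ = z₀₁`. [cite: tHooft1979Flux, §6 eq. (6.1)] -/
theorem dualityRotation_apply_23 (z : Twist 4 G) (h : (2 : Fin 4) < 3) :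
    invertDir 0 (invertDir 2 (transposeTwist 0 3 (transposeTwist 1 2 z))) ⟨(2, 3), h⟩ = z ⟨(0, 1), by decide⟩ := by
  rw [invertDir_apply, if_neg (show ¬((2 : Fin 4) = 0 ∨ (3 : Fin 4) = 0) by decide), invertDir_apply, if_pos (Or.inl rfl)]
  change (extend (transposeTwist 1 2 z) (Equiv.swap (0 : Fin 4) 3 2) (Equiv.swap (0 : Fin 4) 3 3))⁻¹ = _
  rw [extend_transposeTwist,
    show Equiv.swap (1 : Fin 4) 2 (Equiv.swap (0 : Fin 4) 3 2) = 1 by decide,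
    show Equiv.swap (1 : Fin 4) 2 (Equiv.swap (0 : Fin 4) 3 3) = 0 by decide,
    extend_of_gt z (show (0 : Fin 4) < 1 by decide), inv_inv]

end Components

/-! ## `Z` is invariant under the rotation; (6.2) for `SU(N)` -/

section Covariance

variable {L N : ℕ} [NeZero L] {G : Type*} [Group G] [TopologicalSpace G] [IsTopologicalGroup G] [CompactSpace G]
  [MeasurableSpace G] [BorelSpace G] (ρ : G →* Matrix (Fin N) (Fin N) ℂ) (β : ℝ)

/-- ★ **`W` is invariant under the rotation (6.1)**: `Z(Rz) = Z(z)`,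
`R = invertDir 0 ∘ invertDir 2 ∘ transposeTwist 0 3 ∘ transposeTwist 1 2`, for every twist `z` of the symmetric
four-torus (any compact `G`, continuous `ρ`, real `β`, `L ≥ 2`) — two transposition covariances and two axis-reversal
covariances. [cite: tHooft1979Flux, §6 first sentence and eqs. (6.1)–(6.2)] -/
theorem twistZ_dualityRotation (hL : 1 < L) (hρ : Continuous ρ) (z : Twist 4 G) :
    TwistedSector.twistZ ρ (invertDir 0 (invertDir 2 (transposeTwist 0 3 (transposeTwist 1 2 z)))) β L =
      TwistedSector.twistZ ρ z β L := by
  rw [twistZ_invertDir ρ β hL hρ, twistZ_invertDir ρ β hL hρ, twistZ_transposeTwist ρ β hρ,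
    twistZ_transposeTwist ρ β hρ]

end Covariance

section SUN

variable {N : ℕ} [NeZero N]

/-- `(ω^a · 1)⁻¹ = ω^{-a} · 1` (from `twistOfTensor_neg`, pointwise). [cite: tHooft1979Flux, §2 eq. (2.5)] -/
private theorem suCenter_inv_eq (a : ZMod N) : (suCenter N a)⁻¹ = suCenter N (-a) := by
  have h := congrFun (twistOfTensor_neg (n := 3) (fun _ => a)) ⟨(0, 1), by decide⟩
  rw [Pi.inv_apply] at h
  exact h.symm

/-- **The rotation (6.1) on 't Hooft's tensors**: `R` carries the twist of `{k, m} = {(k₁,k₂,k₃), (m₁,m₂,m₃)}` to the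
twist of `{(m₁,m₂,k₃), (k₁,k₂,m₃)}` — `k̃ ↔ m̃` exchanged, `k₃`, `m₃` kept, all signs matching under `n_{ij} = ε_{ijk} m_k`.
[cite: tHooft1979Flux, §6 eqs. (6.1)–(6.2)] -/
theorem dualityRotation_twistOfTensor (k m : Fin 3 → ZMod N) :
    invertDir 0 (invertDir 2 (transposeTwist 0 3 (transposeTwist 1 2
        (twistOfTensor N (THooftFlux.magneticTensor m + THooftFlux.temporalTensor k))))) =
      twistOfTensor N (THooftFlux.magneticTensor ![k 0, k 1, m 2] + THooftFlux.temporalTensor ![m 0, m 1, k 2]) := by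
  funext q
  obtain ⟨⟨i, j⟩, hij⟩ := q
  change _ = suCenter N ((THooftFlux.magneticTensor ![k 0, k 1, m 2] + THooftFlux.temporalTensor ![m 0, m 1, k 2])
    ⟨(i, j), hij⟩)
  fin_cases i <;> fin_cases j
  all_goals (first | exact absurd hij (by decide) | skip)
  · -- (0, 1)
    change invertDir 0 (invertDir 2 (transposeTwist 0 3 (transposeTwist 1 2 (twistOfTensor N (THooftFlux.magneticTensor m + THooftFlux.temporalTensor k)))))
        ⟨((0 : Fin 4), (1 : Fin 4)), by decide⟩ = suCenter N ((THooftFlux.magneticTensor ![k 0, k 1, m 2] + THooftFlux.temporalTensor ![m 0, m 1, k 2]) ⟨((0 : Fin 4), (1 : Fin 4)), by decide⟩)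
    rw [dualityRotation_apply_01, THooftFlux.fluxTensor_apply_01]
    change suCenter N ((THooftFlux.magneticTensor m + THooftFlux.temporalTensor k) ⟨(2, 3), _⟩) = _
    rw [THooftFlux.fluxTensor_apply_23]
    rfl
  · -- (0, 2)
    change invertDir 0 (invertDir 2 (transposeTwist 0 3 (transposeTwist 1 2 (twistOfTensor N (THooftFlux.magneticTensor m + THooftFlux.temporalTensor k)))))
        ⟨((0 : Fin 4), (2 : Fin 4)), by decide⟩ = suCenter N ((THooftFlux.magneticTensor ![k 0, k 1, m 2] + THooftFlux.temporalTensor ![m 0, m 1, k 2]) ⟨((0 : Fin 4), (2 : Fin 4)), by decide⟩)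
    rw [dualityRotation_apply_02, THooftFlux.fluxTensor_apply_02]
    change (suCenter N ((THooftFlux.magneticTensor m + THooftFlux.temporalTensor k) ⟨(1, 3), _⟩))⁻¹ = _
    rw [THooftFlux.fluxTensor_apply_13, suCenter_inv_eq, neg_neg]
    rfl
  · -- (0, 3)
    change invertDir 0 (invertDir 2 (transposeTwist 0 3 (transposeTwist 1 2 (twistOfTensor N (THooftFlux.magneticTensor m + THooftFlux.temporalTensor k)))))
        ⟨((0 : Fin 4), (3 : Fin 4)), by decide⟩ = suCenter N ((THooftFlux.magneticTensor ![k 0, k 1, m 2] + THooftFlux.temporalTensor ![m 0, m 1, k 2]) ⟨((0 : Fin 4), (3 : Fin 4)), by decide⟩)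
    rw [dualityRotation_apply_03, THooftFlux.fluxTensor_apply_03]
    change suCenter N ((THooftFlux.magneticTensor m + THooftFlux.temporalTensor k) ⟨(0, 3), _⟩) = _
    rw [THooftFlux.fluxTensor_apply_03]
    rfl
  · -- (1, 2)
    change invertDir 0 (invertDir 2 (transposeTwist 0 3 (transposeTwist 1 2 (twistOfTensor N (THooftFlux.magneticTensor m + THooftFlux.temporalTensor k)))))
        ⟨((1 : Fin 4), (2 : Fin 4)), by decide⟩ = suCenter N ((THooftFlux.magneticTensor ![k 0, k 1, m 2] + THooftFlux.temporalTensor ![m 0, m 1, k 2]) ⟨((1 : Fin 4), (2 : Fin 4)), by decide⟩)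
    rw [dualityRotation_apply_12, THooftFlux.fluxTensor_apply_12]
    change suCenter N ((THooftFlux.magneticTensor m + THooftFlux.temporalTensor k) ⟨(1, 2), _⟩) = _
    rw [THooftFlux.fluxTensor_apply_12]
    rfl
  · -- (1, 3)
    change invertDir 0 (invertDir 2 (transposeTwist 0 3 (transposeTwist 1 2 (twistOfTensor N (THooftFlux.magneticTensor m + THooftFlux.temporalTensor k)))))
        ⟨((1 : Fin 4), (3 : Fin 4)), by decide⟩ = suCenter N ((THooftFlux.magneticTensor ![k 0, k 1, m 2] + THooftFlux.temporalTensor ![m 0, m 1, k 2]) ⟨((1 : Fin 4), (3 : Fin 4)), by decide⟩)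
    rw [dualityRotation_apply_13, THooftFlux.fluxTensor_apply_13]
    change (suCenter N ((THooftFlux.magneticTensor m + THooftFlux.temporalTensor k) ⟨(0, 2), _⟩))⁻¹ = _
    rw [THooftFlux.fluxTensor_apply_02, suCenter_inv_eq]
    rfl
  · -- (2, 3)
    change invertDir 0 (invertDir 2 (transposeTwist 0 3 (transposeTwist 1 2 (twistOfTensor N (THooftFlux.magneticTensor m + THooftFlux.temporalTensor k)))))
        ⟨((2 : Fin 4), (3 : Fin 4)), by decide⟩ = suCenter N ((THooftFlux.magneticTensor ![k 0, k 1, m 2] + THooftFlux.temporalTensor ![m 0, m 1, k 2]) ⟨((2 : Fin 4), (3 : Fin 4)), by decide⟩)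
    rw [dualityRotation_apply_23, THooftFlux.fluxTensor_apply_23]
    change suCenter N ((THooftFlux.magneticTensor m + THooftFlux.temporalTensor k) ⟨(0, 1), _⟩) = _
    rw [THooftFlux.fluxTensor_apply_01]
    rfl

/-- ★★ **'t Hooft's (6.2) on the symmetric torus**: for `SU(N)`, every `β`, every `L ≥ 2` and all
`k, m ∈ ℤ_N³`, `W{(k₁,k₂,k₃), (m₁,m₂,m₃)} = W{(m₁,m₂,k₃), (k₁,k₂,m₃)}` — «`W{k̃, k₃, m̃, m₃} = W{m̃, k₃, k̃, m₃}`»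
(the box arguments `ã, a₃, β ↦ â, β, a₃` of the printed equation coincide on the symmetric torus).
[cite: tHooft1979Flux, §6 eq. (6.2)] -/
theorem sun_twistZ_duality {L : ℕ} [NeZero L] (hL : 1 < L) (β : ℝ) (k m : Fin 3 → ZMod N) :
    TwistedSector.twistZ (fundamentalRep (Fin N))
        (twistOfTensor N (THooftFlux.magneticTensor ![k 0, k 1, m 2] + THooftFlux.temporalTensor ![m 0, m 1, k 2])) β L =
      TwistedSector.twistZ (fundamentalRep (Fin N))
        (twistOfTensor N (THooftFlux.magneticTensor m + THooftFlux.temporalTensor k)) β L := by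
  rw [← dualityRotation_twistOfTensor k m, twistZ_dualityRotation _ β hL (continuous_fundamentalRep (Fin N))]

end SUN

end MultiTwist

end

end Literature.MathematicalPhysics.QuantumFieldTheory
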